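import Summits.QuantumFields.BalabanUV.T4Continuum.Spine.NE1p.DressedMGFForm
import Literature.MathematicalPhysics.QuantumFieldTheory.Balaban1983to89.B16Ineq175Tilted

/-!
# BalabanUVNodes ∕ node N14 = NE1′ — THE TWO CURRENCIES OF THE ROW AGREE AT REAL DATA: [Balaban1989LargeFieldII]'s complex-weight tilted
# normalised expectation (`B16Ineq175Tilted.tiltedMean`, the (1.75)ₜ currency of the decl of record's estimate layer) IS the MGF road's
# source-tilted mean (`DressedMGFForm.tiltedMean`, Mathlib `Measure.tilted`, the currency of the residual `TiltedMeanMatching` :253) when the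
# small exponential term, the observable and the source are REAL — a vocabulary bridge, count-neutral

Cell `pub-ymgap`, HUMAN RULING D-0062 (Track A at full width), seat `pub-ymgap-dag-n14-c` (R134 ACCELERATION, strategy s1), generation 2; route
`Summits/QuantumFields/YangMills/Theses/BalabanUVNodes.lean` (cluster K3, `--supports`); venue ruling R424 (`YangMills/Theorems`, namespace
`YMDAG.N14.Currencies`).  ADDITIVE — imports the gaps-ne1 module `Spine/NE1p/DressedMGFForm` (p341456: `tiltedMean F ν s = ∫F d(ν.tilted (s·F))`,
`TiltedMeanMatching`) and dag-n14-b's `B16Ineq175Tilted` (p409237: `tiltWeight`, complex `tiltedMean`) ONLY; one bookkeeping `def` (the positive law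
of the real data) + theorems; modifies nothing.

WHY.  The director's R134 row for N14 names two decls in two currencies: the decl of record's estimate layer is typed in [B16]'s COMPLEX-WEIGHT
currency (`ρ₀e^{σ+tW}`, `σ` *"possible complex valued"*, complex source `t` — `B16Ineq175Tilted`, `B16DressedActionTerm`, this seat's
`…N14DecoupledDressing*`), the residual `TiltedMeanMatching` (:253) in the MGF road's REAL currency (finite positive measures `ν`, real tilt `s`,
Mathlib `Measure.tilted`; `DressedMGFForm`, `TiltedMeanCrossover`, n14-a's `…N14TiltedMatching`).  `B16DressedActionTerm`'s header records that for
complex `σ` Mathlib's `cgf` ∕ `Measure.tilted` do not apply.  At REAL data they do, and the two notions of «source-tilted mean of the observable»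
coincide — this file proves it, so that statements made in one currency (e.g. this seat's residual twin `norm_tiltedMeanSum_succ_sub_le`, per fibre)
can be read in the other at real data:
* `realLaw μ ρ₀ σ` [bookkeeping def] — the finite positive law `ρ₀e^{σ}·μ` of the MGF road built from [B16]'s real regular data (`withDensity`).
* `integral_realLaw` — `∫ g d(realLaw) = ∫ ρ₀e^{σ}·g dμ` for `ρ₀ ≥ 0` a.e. (Mathlib `integral_withDensity_eq_integral_smul₀`).
* `tiltWeight_ofReal` — at real `σ, W, s` the tilted weight is the real positive density `ρ₀e^{σ+sW}` coerced.
* **`tiltedMean_ofReal_eq`** — `B16Ineq175Tilted.tiltedMean μ ρ₀ ↑σ ↑W ↑W ↑s = ↑(DressedMGFForm.tiltedMean W (realLaw μ ρ₀ σ) s)`: the complex-weight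
  normalised expectation of the observable under the `s`-tilted weight IS the mean of the observable under the `s·W`-tilted positive law
  (Mathlib `integral_tilted`; both sides carry the same junk convention `0⁻¹ = 0` when the normalisation vanishes, so NO integrability hypothesis
  is needed beyond measurability of the density and `ρ₀ ≥ 0` a.e.).
* `tiltedMean_ofReal_re` ∕ `tiltedMean_ofReal_im` — hence the complex tilted mean is real at real data (its imaginary part vanishes).

HONEST FRAMING.  [folklore] measure-theoretic bookkeeping (change of density, Mathlib's tilted measure); nothing of Bałaban's densities is asserted;
`TiltedMeanMatching` is NOT instantiated on the runs of record (that needs the product law realising `F_K = Σ_n W_n` on Bałaban's histories —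
NODE O); N14 NOT discharged; count-neutral.  One finite four-torus programme at fixed ε; NOT ℝ⁴, NOT OS, NOT a mass gap, NOT Clay.  0 sorry.
-/

noncomputable section

namespace YMDAG.N14.Currencies

open MeasureTheory
open scoped ENNReal NNReal
open Literature.MathematicalPhysics.QuantumFieldTheory.Balaban1983to89
open Summit.QuantumFields.BalabanUV.T4Continuum.NE1p

variable {Z : Type*} [MeasurableSpace Z]

/-- **THE POSITIVE LAW OF THE REAL DATA** [bookkeeping]: `realLaw μ ρ₀ σ = ρ₀·e^{σ}·μ` — the MGF road's finite measure built from [B16]'s real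
regular density `ρ₀ ≥ 0` and a REAL small exponential term `σ` (`withDensity` with the density `ENNReal.ofReal (ρ₀·e^{σ})`). -/
def realLaw (μ : Measure Z) (ρ₀ σ : Z → ℝ) : Measure Z :=
  μ.withDensity fun z => ENNReal.ofReal (ρ₀ z * Real.exp (σ z))

variable {μ : Measure Z} {ρ₀ σ W : Z → ℝ}

/-- **INTEGRATION AGAINST THE REAL LAW** [folklore]: for `ρ₀ ≥ 0` a.e. and measurable data, `∫ g d(realLaw μ ρ₀ σ) = ∫ (ρ₀e^{σ}) • g dμ`
(Mathlib `integral_withDensity_eq_integral_smul₀`, the `ℝ≥0`-valued density `(ρ₀e^{σ}).toNNReal` agreeing with `ρ₀e^{σ}` a.e.). -/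
theorem integral_realLaw {E : Type*} [NormedAddCommGroup E] [NormedSpace ℝ E] (hρm : AEMeasurable ρ₀ μ) (hσm : AEMeasurable σ μ)
    (hρ0 : 0 ≤ᵐ[μ] ρ₀) (g : Z → E) :
    ∫ z, g z ∂(realLaw μ ρ₀ σ) = ∫ z, (ρ₀ z * Real.exp (σ z)) • g z ∂μ := by
  have hf : AEMeasurable (fun z => (ρ₀ z * Real.exp (σ z)).toNNReal) μ :=
    (hρm.mul (Real.measurable_exp.comp_aemeasurable hσm)).real_toNNReal
  have h := integral_withDensity_eq_integral_smul₀ hf g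
  rw [realLaw]
  refine h.trans (integral_congr_ae ?_)
  filter_upwards [hρ0] with z hz
  have hnn : 0 ≤ ρ₀ z * Real.exp (σ z) := mul_nonneg hz (Real.exp_pos _).le
  rw [NNReal.smul_def, Real.coe_toNNReal _ hnn]

omit [MeasurableSpace Z] in
/-- **AT REAL DATA THE TILTED WEIGHT IS A REAL POSITIVE DENSITY** [folklore]: `tiltWeight ρ₀ ↑σ ↑W ↑s z = ↑(ρ₀ z · e^{σ z + s·W z})`. -/
theorem tiltWeight_ofReal (ρ₀ σ W : Z → ℝ) (s : ℝ) (z : Z) :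
    B16Ineq175Tilted.tiltWeight ρ₀ (fun z => (σ z : ℂ)) (fun z => (W z : ℂ)) (s : ℂ) z =
      ((ρ₀ z * Real.exp (σ z + s * W z) : ℝ) : ℂ) := by
  rw [B16Ineq175Tilted.tiltWeight_apply]
  push_cast
  rfl

/-- The tilted normalisation at real data is the real integral `∫ρ₀e^{σ+sW}dμ`, coerced. [folklore] -/
theorem integral_tiltWeight_ofReal (ρ₀ σ W : Z → ℝ) (s : ℝ) :
    ∫ z, B16Ineq175Tilted.tiltWeight ρ₀ (fun z => (σ z : ℂ)) (fun z => (W z : ℂ)) (s : ℂ) z ∂μ =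
      ((∫ z, ρ₀ z * Real.exp (σ z + s * W z) ∂μ : ℝ) : ℂ) := by
  simp_rw [tiltWeight_ofReal]
  exact integral_complex_ofReal

/-- The tilted un-normalised term at real data with the observable attached is the real integral `∫ρ₀e^{σ+sW}·W dμ`, coerced. [folklore] -/
theorem integral_tiltWeight_smul_ofReal (ρ₀ σ W : Z → ℝ) (s : ℝ) :
    ∫ z, B16Ineq175Tilted.tiltWeight ρ₀ (fun z => (σ z : ℂ)) (fun z => (W z : ℂ)) (s : ℂ) z • ((W z : ℝ) : ℂ) ∂μ =
      ((∫ z, ρ₀ z * Real.exp (σ z + s * W z) * W z ∂μ : ℝ) : ℂ) := by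
  simp_rw [tiltWeight_ofReal, smul_eq_mul]
  rw [← integral_complex_ofReal]
  refine integral_congr_ae (Filter.Eventually.of_forall fun z => ?_)
  push_cast
  ring

/-- **THE TWO CURRENCIES AGREE AT REAL DATA** [folklore]: for `ρ₀ ≥ 0` a.e. and measurable real `ρ₀, σ, W`, at every real source `s`
`B16Ineq175Tilted.tiltedMean μ ρ₀ ↑σ ↑W ↑W ↑s = ↑(DressedMGFForm.tiltedMean W (realLaw μ ρ₀ σ) s)` — [B16]'s complex-weight normalised expectation
of the observable under the weight `ρ₀e^{σ+sW}` IS the mean of `W` under the `s·W`-tilt of the positive law `ρ₀e^{σ}μ` (Mathlib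
`integral_tilted`: `∫ g d(ν.tilted f) = ∫ (e^{f}∕∫e^{f}dν)•g dν`; the same junk convention on both sides, so no integrability hypothesis). -/
theorem tiltedMean_ofReal_eq (hρm : AEMeasurable ρ₀ μ) (hσm : AEMeasurable σ μ) (hρ0 : 0 ≤ᵐ[μ] ρ₀) (W : Z → ℝ) (s : ℝ) :
    B16Ineq175Tilted.tiltedMean μ ρ₀ (fun z => (σ z : ℂ)) (fun z => (W z : ℂ)) (fun z => (W z : ℂ)) (s : ℂ) =
      ((DressedMGFForm.tiltedMean W (realLaw μ ρ₀ σ) s : ℝ) : ℂ) := by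
  -- left: the two complex integrals are real integrals coerced
  rw [B16Ineq175Tilted.tiltedMean, integral_tiltWeight_ofReal, integral_tiltWeight_smul_ofReal, smul_eq_mul, ← Complex.ofReal_inv,
    ← Complex.ofReal_mul]
  congr 1
  -- right: Mathlib's tilted integral against the real law, then the change of density
  rw [DressedMGFForm.tiltedMean, integral_tilted, integral_realLaw hρm hσm hρ0, integral_realLaw hρm hσm hρ0]
  -- pull the normalisation out and merge the exponentials
  have hexp : ∀ z, ρ₀ z * Real.exp (σ z) * Real.exp (s * W z) = ρ₀ z * Real.exp (σ z + s * W z) := fun z => by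
    rw [Real.exp_add]; ring
  simp_rw [smul_eq_mul, hexp]
  rw [← integral_const_mul]
  refine integral_congr_ae (Filter.Eventually.of_forall fun z => ?_)
  dsimp only
  rw [← hexp z]
  ring

/-- Hence at real data the complex tilted mean is REAL: its imaginary part vanishes. [folklore] -/
theorem tiltedMean_ofReal_im (hρm : AEMeasurable ρ₀ μ) (hσm : AEMeasurable σ μ) (hρ0 : 0 ≤ᵐ[μ] ρ₀) (W : Z → ℝ) (s : ℝ) :
    (B16Ineq175Tilted.tiltedMean μ ρ₀ (fun z => (σ z : ℂ)) (fun z => (W z : ℂ)) (fun z => (W z : ℂ)) (s : ℂ)).im = 0 := by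
  rw [tiltedMean_ofReal_eq hρm hσm hρ0 W s, Complex.ofReal_im]

/-- … and its real part is the MGF road's tilted mean. [folklore] -/
theorem tiltedMean_ofReal_re (hρm : AEMeasurable ρ₀ μ) (hσm : AEMeasurable σ μ) (hρ0 : 0 ≤ᵐ[μ] ρ₀) (W : Z → ℝ) (s : ℝ) :
    (B16Ineq175Tilted.tiltedMean μ ρ₀ (fun z => (σ z : ℂ)) (fun z => (W z : ℂ)) (fun z => (W z : ℂ)) (s : ℂ)).re =
      DressedMGFForm.tiltedMean W (realLaw μ ρ₀ σ) s := by
  rw [tiltedMean_ofReal_eq hρm hσm hρ0 W s, Complex.ofReal_re]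

end YMDAG.N14.Currencies

end
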